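import Summits.SmoothPoincare4.SmoothPoincare4.Theorems.CongruenceShadowsAgkCor6SufficiencyFlowerCapDefs
import HarnessLib

/-!
# Stub `stub_capCollarsArc` of line `lp-by-sphere-system-surgery` for crux `AgkCor6Sufficiency`
(item stmt-SmoothPoincare4-10894, routes `CongruenceShadows` / `GroupTrisection`; lead reshape r6b)

**The arc collars of the capped melon** on the flower surface `Z_g = FlowerModel.flowerSurface g`
(`g = n + 2`, `1 ≤ k ≤ n`): the `k`-th pole-to-pole arc `FlowerModel.arcK hg k` minus the open
polar cap `capU = {‖proj p‖ < 1/4 ∧ 0 < p 2}` is a strong deformation retract of an open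
neighbourhood of it inside the fan `⋃_{j ≤ k-1} secS g j` minus the cap, and inside the slice
`secS g k` minus the cap — the capped versions of the tree's `FlowerModel.collar_fan` and
`FlowerModel.collar_secS`.

Both tree collars are transports, along the isometries `Rk g k` resp. `refl3.trans (Rk g m)`
(`k = m + 1`), of the fan collar `FlowerModel.isStrongDeformationRetractOf_vArcSet_fan`, which is
the sheetwise lift (`PlanarDouble.isStrongDeformationRetractOf_double'`, map `PlanarDouble.liftMap`)
of the planar angular squeeze `FlowerModel.fanψ`.  The point of the cap radius `1/4`: the squeeze
never moves a point of planar radius `≥ 1/4` below `1/4` (`FlowerModel.far_of_mem`,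
`FlowerModel.newRadius_mem`: the blended radius `‖u‖ + λ(‖u‖)(R_s - ‖u‖)` is `≥ ‖u‖`), and the lift
keeps the sign of the height (`PlanarDouble.liftMap_apply_two`), so the complement of `capU` is
invariant under the whole deformation.  We therefore re-run the lifting lemma with an invariant
set threaded through (`isStrongDeformationRetractOf_double'_inter`), obtain the capped fan collar,
and transport it exactly as the tree does, using that `Rk g k` and `refl3` map `capU` onto itself
(they preserve `‖proj ·‖` and the height).

References: Hatcher, *Algebraic Topology* (2002), Ch. 0 p. 2 (deformation retractions), §1.2
pp. 50–52 [HatcherAT2002].  No `sorry`.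
-/

set_option linter.dupNamespace false

noncomputable section

open Set Function Metric
open scoped Real unitInterval Manifold ContDiff Topology

namespace Summit.SmoothPoincare4.SmoothPoincare4.Cruxes.AgkCor6Sufficiency.LpBySphereSystemSurgery

open Literature.Topology.FourManifolds Literature.Topology.FourManifolds.FlowerModel
open PlanarThickening PlanarDouble
open Literature.AlgebraicTopology.FundamentalGroup Literature.AlgebraicTopology.FundamentalGroup.VanKampen
  Literature.AlgebraicTopology.Homotopy

namespace FlowerCap

/-! ## Helpers -/

/-- **Lifting a seam-preserving planar deformation to the double, with an invariant set.**  As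
`PlanarDouble.isStrongDeformationRetractOf_double'` (same lift `(u, ±√(c - q u)) ↦
(ψ_t u, ±√(c - q(ψ_t u)))`, same proof), but restricted to a set `T ⊆ ℝ³` that the lift maps into
itself over `W`: then `Z ∩ π⁻¹(K) ∩ T` is a strong deformation retract of `Z ∩ π⁻¹(W) ∩ T`. -/
private theorem isStrongDeformationRetractOf_double'_inter {q : EuclideanSpace ℝ (Fin 2) → ℝ} {c : ℝ}
    (hq : Continuous q) {W K : Set (EuclideanSpace ℝ (Fin 2))}
    (ψ : ℝ → EuclideanSpace ℝ (Fin 2) → EuclideanSpace ℝ (Fin 2))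
    (hcont : ContinuousOn (fun x : ℝ × EuclideanSpace ℝ (Fin 2) => ψ x.1 x.2) (Icc (0 : ℝ) 1 ×ˢ W))
    (hmaps : ∀ t ∈ Icc (0 : ℝ) 1, MapsTo (ψ t) W W) (hsub : ∀ u ∈ W, q u ≤ c)
    (hseam : ∀ t ∈ Icc (0 : ℝ) 1, ∀ u ∈ W, q u = c → q (ψ t u) = c)
    (h0 : ∀ u ∈ W, ψ 0 u = u) (h1 : ∀ u ∈ W, ψ 1 u ∈ K)
    (hfix : ∀ t ∈ Icc (0 : ℝ) 1, ∀ u ∈ W, u ∈ K → ψ t u = u)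
    (T : Set (EuclideanSpace ℝ (Fin 3)))
    (hT : ∀ t ∈ Icc (0 : ℝ) 1, ∀ p ∈ double q c ∩ proj ⁻¹' W, p ∈ T → liftMap q c (ψ t) p ∈ T) :
    IsStrongDeformationRetractOf (double q c ∩ proj ⁻¹' K ∩ T) (double q c ∩ proj ⁻¹' W ∩ T) := by
  refine IsStrongDeformationRetractOf.of_continuousOn (fun t p => liftMap q c (ψ t) p) ?_ ?_ ?_ ?_ ?_
  · -- continuity on `[0, 1] × (double over W, inside T)`
    have hφ : ContinuousOn (fun x : ℝ × EuclideanSpace ℝ (Fin 3) => ψ x.1 (proj x.2))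
        (Icc (0 : ℝ) 1 ×ˢ (double q c ∩ proj ⁻¹' W ∩ T)) := by
      refine hcont.comp (continuous_fst.prodMk (proj.continuous.comp continuous_snd)).continuousOn ?_
      rintro ⟨t, p⟩ ⟨ht, ⟨-, hp⟩, -⟩
      exact ⟨ht, hp⟩
    have hroot : ContinuousOn (fun x : ℝ × EuclideanSpace ℝ (Fin 3) => Real.sqrt (c - q (ψ x.1 (proj x.2))))
        (Icc (0 : ℝ) 1 ×ˢ (double q c ∩ proj ⁻¹' W ∩ T)) :=
      Real.continuous_sqrt.comp_continuousOn (continuousOn_const.sub (hq.comp_continuousOn hφ))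
    have hz : ContinuousOn (fun x : ℝ × EuclideanSpace ℝ (Fin 3) => x.2 2)
        (Icc (0 : ℝ) 1 ×ˢ (double q c ∩ proj ⁻¹' W ∩ T)) :=
      ((EuclideanSpace.proj (2 : Fin 3)).continuous.comp continuous_snd).continuousOn
    have hscal := continuousOn_sign_mul hz hroot (by
      rintro ⟨t, p⟩ ⟨ht, ⟨hp, hpW⟩, -⟩ h2
      simp only at h2 ⊢
      have hseam' : q (proj p) = c := (apply_two_eq_zero_iff hp).1 h2
      rw [hseam t ht (proj p) hpW hseam', sub_self, Real.sqrt_zero])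
    simp only [liftMap]
    exact (lift.continuous.comp_continuousOn hφ).add (hscal.smul continuousOn_const)
  · rintro t ht p ⟨⟨hp, hpW⟩, hpT⟩
    refine ⟨⟨liftMap_mem' hp ?_ (hseam t ht _ hpW), ?_⟩, hT t ht p ⟨hp, hpW⟩ hpT⟩
    · exact hsub _ (hmaps t ht hpW)
    · show proj (liftMap q c (ψ t) p) ∈ W
      rw [proj_liftMap]; exact hmaps t ht hpW
  · rintro p ⟨⟨hp, hpW⟩, -⟩
    exact liftMap_eq_self hp (h0 _ hpW)
  · rintro p ⟨⟨hp, hpW⟩, hpT⟩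
    refine ⟨⟨liftMap_mem' hp (hsub _ (hmaps 1 ⟨zero_le_one, le_rfl⟩ hpW))
      (hseam 1 ⟨zero_le_one, le_rfl⟩ _ hpW), ?_⟩, hT 1 ⟨zero_le_one, le_rfl⟩ p ⟨hp, hpW⟩ hpT⟩
    show proj (liftMap q c (ψ 1) p) ∈ K
    rw [proj_liftMap]; exact h1 _ hpW
  · rintro t ht p ⟨⟨hp, hpW⟩, -⟩ ⟨⟨-, hpK⟩, -⟩
    exact liftMap_eq_self hp (hfix t ht _ hpW hpK)

variable {g : ℕ}

/-- **The complement of the cap is invariant under the lifted fan collar deformation**: on the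
lower sheet and the seam the new height `sign(p₂) · √(…)` is `≤ 0`; on the upper sheet a point
outside the cap has planar radius `≥ 1/4`, hence lies in the far part of the collar region
(`FlowerModel.far_of_mem`), where the blended new radius is `≥ ‖u‖ ≥ 1/4`
(`FlowerModel.newRadius_mem`). -/
private theorem liftMap_fanψ_not_mem_capU (hg : 2 ≤ g) {m : ℕ} {t : ℝ} (ht : t ∈ Icc (0 : ℝ) 1)
    {p : EuclideanSpace ℝ (Fin 3)} (hpW : proj p ∈ fanW g m ∩ collarU g m) (hp : p ∉ capU) :
    liftMap (flower g) (level g) (fanψ hg m t) p ∉ capU := by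
  rintro ⟨hnorm, hpos⟩
  rw [proj_liftMap] at hnorm
  rw [liftMap_apply_two] at hpos
  rcases le_or_gt (p 2) 0 with h2 | h2
  · -- lower sheet or seam: the new height is not positive
    have hs : Real.sign (p 2) ≤ 0 := by
      rcases h2.lt_or_eq with h | h
      · rw [Real.sign_of_neg h]; norm_num
      · rw [h, Real.sign_zero]
    have : Real.sign (p 2) * Real.sqrt (level g - flower g (fanψ hg m t (proj p))) ≤ 0 :=
      mul_nonpos_of_nonpos_of_nonneg hs (Real.sqrt_nonneg _)
    linarith
  · -- upper sheet: planar radius `≥ 1/4` is not decreased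
    have hr : 1 / 4 ≤ ‖proj p‖ := by
      rw [← capR_eq]
      exact not_lt.1 fun h => hp ⟨h, h2⟩
    obtain ⟨-, hfar⟩ := far_of_mem hpW.2 hr
    have hnew := (newRadius_mem hg ht hpW.1 hfar).1
    have he : ‖fanψ hg m t (proj p)‖ =
        |‖proj p‖ + lam ‖proj p‖ * (Rtot hg (sqAng g m t (proj p)) (flower g (proj p)) - ‖proj p‖)| := by
      rw [fanψ, norm_pol]
    rw [he, capR_eq] at hnorm
    have hle := le_abs_self
      (‖proj p‖ + lam ‖proj p‖ * (Rtot hg (sqAng g m t (proj p)) (flower g (proj p)) - ‖proj p‖))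
    linarith

/-- **The capped fan collar**: over the open collar region, the flower surface over the fan minus
the cap strong deformation retracts onto the valley arc minus the cap (the tree's
`FlowerModel.isStrongDeformationRetractOf_vArcSet_fan`, re-run with the invariant set `capUᶜ`). -/
private theorem isStrongDeformationRetractOf_vArcSet_fan_sdiff (hg : 2 ≤ g) {m : ℕ} (hm : m + 2 ≤ g) :
    IsStrongDeformationRetractOf (vArcSet g hg \ capU)
      (({p | thicken (flower g) p = level g} ∩ proj ⁻¹' (fanW g m ∩ collarU g m)) \ capU) := by
  have h := isStrongDeformationRetractOf_double'_inter (q := flower g) (c := level g)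
    contDiff_flower.continuous (W := fanW g m ∩ collarU g m) (K := vRay g hg) (fanψ hg m)
    ((continuousOn_fanψ hg hm).mono (prod_mono (subset_univ _) le_rfl))
    (fun s hs u hu => fanψ_mem hg hm hs hu.1 hu.2) (fun u hu => hu.1.1)
    (fun s hs u hu hq => flower_fanψ_eq hg hs hu.1 hu.2 hq) (fun u hu => fanψ_zero hg hu.1 hu.2)
    (fun u hu => fanψ_one_mem hg hu.1 hu.2)
    (fun s _ u _ huK => fanψ_eq_self_of_mem_vRay hg hm s huK)
    capUᶜ (fun s hs p hp hpT => liftMap_fanψ_not_mem_capU hg hs hp.2 hpT)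
  exact h

/-- The slice rotations `Rk` map the cap region onto itself (they preserve `‖proj ·‖` and the
height). -/
private theorem preimage_Rk_capU (k : ℕ) : Rk g k ⁻¹' capU = capU := by
  ext p
  simp only [mem_preimage, capU, mem_setOf_eq, Rk, proj_rot3, FlowerModel.norm_rot, rot3_apply_two]

/-- The reflection `refl3` maps the cap region onto itself. -/
private theorem preimage_refl3_capU : refl3 ⁻¹' capU = capU := by
  ext p
  simp only [mem_preimage, capU, mem_setOf_eq, proj_refl3, norm_refl, refl3_apply_two]

/-- Removing the cap commutes with the slice rotations. -/
private theorem image_Rk_sdiff_capU (k : ℕ) (X : Set (EuclideanSpace ℝ (Fin 3))) :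
    Rk g k '' (X \ capU) = Rk g k '' X \ capU := by
  rw [← image_sdiff_preimage, preimage_Rk_capU]

/-- Removing the cap commutes with the reflection. -/
private theorem image_refl3_sdiff_capU (X : Set (EuclideanSpace ℝ (Fin 3))) :
    refl3 '' (X \ capU) = refl3 '' X \ capU := by
  rw [← image_sdiff_preimage, preimage_refl3_capU]

/-- **The capped collar of the `k`-th arc inside the `k`-th slice** (capped `FlowerModel.collar_secS`). -/
private theorem collar_secS_sdiff (hg : 2 ≤ g) (k : ℕ) :
    ∃ O : Set (EuclideanSpace ℝ (Fin 3)), IsOpen O ∧ range (arcK hg k) \ capU ⊆ O ∧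
      IsStrongDeformationRetractOf (range (arcK hg k) \ capU) ((secS g k \ capU) ∩ O) := by
  have h2 : 0 + 2 ≤ g := by omega
  have hT := (isStrongDeformationRetractOf_vArcSet_fan_sdiff hg h2).image_of_isEmbedding (Rk g k).isEmbedding
  have e : Rk g k '' ({p | thicken (flower g) p = level g} ∩ proj ⁻¹' (fanW g 0 ∩ collarU g 0)) =
      secS g k ∩ proj ⁻¹' (FlowerModel.rot (ζC g k)⁻¹ '' collarU g 0) := by
    rw [← flowerSurface_def, image_Rk_inter hg, image_inter (FlowerModel.rot _).injective, fanW_zero, image_rot_inv_wedge hg,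
      preimage_inter, ← inter_assoc, ← secS_eq hg]
  rw [image_Rk_sdiff_capU, image_Rk_sdiff_capU, e, ← range_arcK_eq_image, inter_sdiff_right_comm] at hT
  refine ⟨_, (isOpen_image_rot _ (isOpen_collarU hg h2)).preimage proj.continuous, ?_, hT⟩
  have hsub := image_mono (f := Rk g k) (vArcSet_subset_collar hg h2)
  rw [e, ← range_arcK_eq_image] at hsub
  exact sdiff_subset.trans (hsub.trans inter_subset_right)

/-- **The capped collar of the `k`-th arc inside the fan of the first `k` slices** (`1 ≤ k`,
`k + 2 ≤ g`; capped `FlowerModel.collar_fan`). -/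
private theorem collar_fan_sdiff (hg : 2 ≤ g) {k : ℕ} (hk : 1 ≤ k) (hkg : k + 2 ≤ g) :
    ∃ O : Set (EuclideanSpace ℝ (Fin 3)), IsOpen O ∧ range (arcK hg k) \ capU ⊆ O ∧
      IsStrongDeformationRetractOf (range (arcK hg k) \ capU) (((⋃ j ≤ k - 1, secS g j) \ capU) ∩ O) := by
  obtain ⟨m, rfl⟩ : ∃ m, k = m + 1 := ⟨k - 1, by omega⟩
  have hm : m + 2 ≤ g := by omega
  simp only [Nat.add_sub_cancel]
  set τ : EuclideanSpace ℝ (Fin 3) ≃ₜ EuclideanSpace ℝ (Fin 3) := refl3.trans (Rk g m)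
  have hT := (isStrongDeformationRetractOf_vArcSet_fan_sdiff hg hm).image_of_isEmbedding τ.isEmbedding
  have hτ : (τ : EuclideanSpace ℝ (Fin 3) → EuclideanSpace ℝ (Fin 3)) = Rk g m ∘ refl3 := rfl
  have eD : ∀ X : Set (EuclideanSpace ℝ (Fin 3)), τ '' (X \ capU) = τ '' X \ capU := fun X => by
    rw [hτ, image_comp, image_comp, image_refl3_sdiff_capU, image_Rk_sdiff_capU]
  have eτ : ∀ W : Set (EuclideanSpace ℝ (Fin 2)), τ '' ({p | thicken (flower g) p = level g} ∩ proj ⁻¹' W) =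
      flowerSurface g ∩ proj ⁻¹' ((fun u => FlowerModel.rot (ζC g m)⁻¹ (refl u)) '' W) := by
    intro W
    rw [hτ, image_comp, image_refl3_inter_preimage, ← flowerSurface_def, image_Rk_inter hg, image_image]
  have e : τ '' ({p | thicken (flower g) p = level g} ∩ proj ⁻¹' (fanW g m ∩ collarU g m)) =
      (⋃ j ≤ m, secS g j) ∩ proj ⁻¹' (FlowerModel.rot (ζC g m)⁻¹ '' (refl '' collarU g m)) := by
    have hinj : Injective (fun u => FlowerModel.rot (ζC g m)⁻¹ (refl u)) := (FlowerModel.rot _).injective.comp refl.injective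
    rw [eτ, image_inter hinj, image_fanSymm_fanW hg hm, preimage_inter, ← inter_assoc, ← iUnion_secS_eq hg hm,
      image_image]
  have eA : τ '' vArcSet g hg = range (arcK hg (m + 1)) := by
    show τ '' ({p | thicken (flower g) p = level g} ∩ proj ⁻¹' vRay g hg) = _
    rw [eτ, image_fanSymm_vRay hg m, range_arcK]
  rw [eD, eD, e, eA, inter_sdiff_right_comm] at hT
  refine ⟨_, (isOpen_image_rot _ (isOpen_image_refl (isOpen_collarU hg hm))).preimage proj.continuous, ?_, hT⟩
  have hsub := image_mono (f := τ) (vArcSet_subset_collar hg hm)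
  rw [e, eA] at hsub
  exact sdiff_subset.trans (hsub.trans inter_subset_right)

/-! ## The stub -/

/-- **stub `stub_capCollarsArc` — the arc collars of the capped melon** (`g = n + 2`,
`1 ≤ k ≤ n`): the `k`-th arc minus the polar cap, `range (arcK hg k) \ capU`, is a strong
deformation retract of an open neighbourhood of it in the capped fan
`(⋃_{j ≤ k-1} secS (n+2) j) \ capU` and of one in the capped slice `secS (n+2) k \ capU`.
Proof: the tree's fan collar deformation (the sheetwise lift of the angular squeeze
`FlowerModel.fanψ`) never enters the cap from outside — on the upper sheet it does not decrease
planar radii `≥ 1/4`, and it keeps the sign of the height — so it restricts to the complements of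
the cap; then transport along the slice symmetries `Rk`, `refl3`, which preserve the cap. -/
theorem stub_capCollarsArc : ∀ {n : ℕ} (hg : 2 ≤ n + 2) (k : ℕ) (hk : 1 ≤ k) (hkn : k ≤ n),
    (∃ O : Set (EuclideanSpace ℝ (Fin 3)), IsOpen O ∧ range (arcK hg k) \ capU ⊆ O ∧
      IsStrongDeformationRetractOf (range (arcK hg k) \ capU) (((⋃ j ≤ k - 1, secS (n + 2) j) \ capU) ∩ O)) ∧
    (∃ O : Set (EuclideanSpace ℝ (Fin 3)), IsOpen O ∧ range (arcK hg k) \ capU ⊆ O ∧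
      IsStrongDeformationRetractOf (range (arcK hg k) \ capU) ((secS (n + 2) k \ capU) ∩ O)) := by
  intro n hg k hk hkn
  exact ⟨collar_fan_sdiff hg hk (by omega), collar_secS_sdiff hg k⟩

end FlowerCap

end Summit.SmoothPoincare4.SmoothPoincare4.Cruxes.AgkCor6Sufficiency.LpBySphereSystemSurgery

end
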